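import Summits.MatrixMultiplication.MatrixMultiplication.Theses.SnSubsetDichotomy
import Literature.NumberTheory.DiophantineGeometry.PartitionTableaux
import Literature.NumberTheory.DiophantineGeometry.FirstRowPeeling
import Literature.NumberTheory.DiophantineGeometry.SymmetricGroupReps
import Literature.NumberTheory.DiophantineGeometry.SymmetricGroupRepsFinrankSpechtProofs
import Literature.NumberTheory.DiophantineGeometry.SymmetricGroupRepsSignTwist

/-!
# Stub `stub_partitionNumerics` (crux stmt-MatrixMultiplication-8303, line flat-tail-truncation)

Crux `Summit.MatrixMultiplication.MatrixMultiplication.Theses.SnSubsetDichotomy.GlobalBranch`, line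
`flat-tail-truncation`: the elementary numerics of the partitions labelling the Wedderburn blocks of
`ℂ[𝔖ₙ]` at the two ends of the dominance order.

For `μ ⊢ n`, `n ≥ 1`, write `μ₁ = μ.parts.sup` (largest part, the first row of the Young diagram)
and `μ₁' = card μ.parts` (number of parts, the first column). We prove

* `μ₁ ≤ n` and `μ₁' ≤ n` (the parts are positive and sum to `n`);
* `f^μ ≤ n^{(n - μ₁)} = n!/μ₁!` (`partitionNumerics_numStandardTableaux_le_descFactorial`): peel the
  first row, `μ = (μ₁, ν)` with `ν ⊢ n - μ₁` (`exists_sortedParts_eq_sup_cons`), so that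
  `f^μ ≤ C(n, n - μ₁) f^ν` (`numStandardTableaux_le_choose_mul`, the hook length formula with the
  first-row hooks `≥ μ₁ - s`) and `f^ν ≤ (n - μ₁)!` (a standard tableau is one of the `j!`
  bijective fillings of a diagram with `j` boxes, `partitionNumerics_numStandardTableaux_le_factorial`);
* hence `μ₁ = n → f^μ = 1` (one row; `f^μ ≥ 1` by `numStandardTableaux_pos_holds`) and
  `μ₁ = n - ℓ → f^μ ≤ n^{(ℓ)} = n.descFactorial ℓ`;
* the column versions (`μ₁' = n → f^μ = 1`, `μ₁' = n - ℓ → f^μ ≤ n^{(ℓ)}`) by transposition: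
  `f^{μᵀ} = f^μ` (`partitionNumerics_numStandardTableaux_transpose`, from the linear equivalence
  `S^μ ≃ S^{μᵀ}`, `spechtIdealTransposeEquiv`, and `dim S^μ = f^μ`, `finrank_spechtIdeal_holds`),
  `(μᵀ)₁ = μ₁'` (`partitionNumerics_sup_parts_transpose`) and `card μᵀ.parts = μ₁`
  (`partitionNumerics_card_parts_transpose`), both read off the Young diagram
  (`rowLen 0 = μ₁`, `colLen 0 = μ₁'`, `Nat.Partition.youngDiagram_transpose`).
-/

set_option linter.dupNamespace false

open scoped BigOperators Matrix ComplexOrder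
open Finset
open Literature.NumberTheory.DiophantineGeometry (numStandardTableaux spechtCharacter)

namespace Summit.MatrixMultiplication.MatrixMultiplication.Theorems.GlobalBranch

open Literature.NumberTheory.DiophantineGeometry

section PartitionNumerics

variable {n : ℕ}

/-! ### Largest part and number of parts -/

/-- The largest part of a partition of `n` is at most `n`. [folklore] -/
theorem partitionNumerics_sup_parts_le (μ : Nat.Partition n) : μ.parts.sup ≤ n :=
  -- adapted from Literature/Computability/Complexity/OccurrenceObstructionsBIP.lean (sup_parts_le)
  Multiset.sup_le.2 fun _ hb => (Multiset.le_sum_of_mem hb).trans_eq μ.parts_sum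

/-- A partition of `n` has at most `n` parts (each part is `≥ 1`). [folklore] -/
theorem partitionNumerics_card_parts_le (μ : Nat.Partition n) : Multiset.card μ.parts ≤ n := by
  -- adapted from Literature/Computability/AlgebraicComplexity/QuantumFunctionalsDimensionBounds.lean
  -- (card_parts_le)
  have h : (μ.parts.map fun _ => 1).sum ≤ (μ.parts.map id).sum :=
    Multiset.sum_map_le_sum_map _ _ fun a ha => μ.parts_pos ha
  rwa [Multiset.map_const', Multiset.sum_replicate, smul_eq_mul, mul_one, Multiset.map_id,
    μ.parts_sum] at h

/-- A partition of `n ≠ 0` has a nonzero largest part. [folklore] -/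
theorem partitionNumerics_sup_parts_ne_zero (hn : n ≠ 0) (μ : Nat.Partition n) :
    μ.parts.sup ≠ 0 := by
  intro h0
  have hall : ∀ b ∈ μ.parts, b ≤ 0 := Multiset.sup_le.1 h0.le
  apply hn
  rw [← μ.parts_sum]
  exact Multiset.sum_eq_zero fun b hb => Nat.le_zero.1 (hall b hb)

/-! ### `f^ν ≤ j!` and `f^μ ≤ n^{(n - μ₁)}` -/

/-- **`f^ν ≤ j!`** for `ν ⊢ j`: the standard Young tableaux of shape `ν` are among the bijective
fillings `Fin j ≃ cells` of its Young diagram (`j` boxes), of which there are `j!`. [folklore] -/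
theorem partitionNumerics_numStandardTableaux_le_factorial {j : ℕ} (ν : Nat.Partition j) :
    numStandardTableaux ν ≤ j.factorial := by
  classical
  have e : Fin j ≃ ν.youngDiagram.cells :=
    (Finset.equivFinOfCardEq ν.card_cells_youngDiagram).symm
  calc numStandardTableaux ν ≤ Nat.card (Fin j ≃ ν.youngDiagram.cells) :=
        Finite.card_subtype_le _
    _ = j.factorial := by
        rw [Nat.card_eq_fintype_card, Fintype.card_equiv e, Fintype.card_fin]

/-- **`f^ν = 1` for the empty partition** `ν ⊢ 0` (the empty diagram has exactly one, empty,
standard tableau: `1 ≤ f^ν ≤ 0! = 1`). [folklore] -/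
theorem partitionNumerics_numStandardTableaux_of_zero (ν : Nat.Partition 0) :
    numStandardTableaux ν = 1 :=
  le_antisymm ((partitionNumerics_numStandardTableaux_le_factorial ν).trans_eq Nat.factorial_zero)
    (Nat.succ_le_of_lt (numStandardTableaux_pos_holds ν))

/-- **`f^μ ≤ n^{(n - μ₁)} = C(n, n - μ₁) · (n - μ₁)!`** for `μ ⊢ n`: peel the first row,
`μ = (μ₁, ν)` with `ν ⊢ n - μ₁`; then `f^μ ≤ C(n, n - μ₁) f^ν` (hook length formula, the hooks of
the first row have product `≥ μ₁!`) and `f^ν ≤ (n - μ₁)!` (for `n = 0` both sides are `1`).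
[folklore] -/
theorem partitionNumerics_numStandardTableaux_le_descFactorial (μ : Nat.Partition n) :
    numStandardTableaux μ ≤ n.descFactorial (n - μ.parts.sup) := by
  rcases Nat.eq_zero_or_pos n with rfl | hn
  · rw [Nat.zero_sub, Nat.descFactorial_zero, partitionNumerics_numStandardTableaux_of_zero μ]
  · obtain ⟨ν, hs⟩ := exists_sortedParts_eq_sup_cons μ hn.ne'
    calc numStandardTableaux μ ≤ n.choose (n - μ.parts.sup) * numStandardTableaux ν :=
          numStandardTableaux_le_choose_mul hs
      _ ≤ n.choose (n - μ.parts.sup) * (n - μ.parts.sup).factorial :=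
          Nat.mul_le_mul_left _ (partitionNumerics_numStandardTableaux_le_factorial ν)
      _ = n.descFactorial (n - μ.parts.sup) := by
          rw [Nat.descFactorial_eq_factorial_mul_choose, mul_comm]

/-- **One row**: if the largest part of `μ ⊢ n` is `n` then `f^μ = 1`. [folklore] -/
theorem partitionNumerics_eq_one_of_sup_eq (μ : Nat.Partition n) (h : μ.parts.sup = n) :
    numStandardTableaux μ = 1 := by
  have h1 := partitionNumerics_numStandardTableaux_le_descFactorial μ
  rw [h, Nat.sub_self, Nat.descFactorial_zero] at h1
  exact le_antisymm h1 (Nat.succ_le_of_lt (numStandardTableaux_pos_holds μ))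

/-- **Row level `ℓ`**: if the largest part of `μ ⊢ n` (`n ≠ 0`) is `n - ℓ` then
`f^μ ≤ n^{(ℓ)} = n!/(n - ℓ)!`. [folklore] -/
theorem partitionNumerics_le_descFactorial_of_sup_eq (hn : n ≠ 0) (μ : Nat.Partition n) {ℓ : ℕ}
    (h : μ.parts.sup = n - ℓ) : numStandardTableaux μ ≤ n.descFactorial ℓ := by
  have hs := partitionNumerics_sup_parts_ne_zero hn μ
  have hℓ : n - μ.parts.sup = ℓ := by omega
  rw [← hℓ]
  exact partitionNumerics_numStandardTableaux_le_descFactorial μ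

/-! ### First row and first column of the Young diagram; transposition -/

/-- The first row of the Young diagram of `μ` has `μ₁ = μ.parts.sup` boxes. [folklore] -/
theorem partitionNumerics_rowLen_youngDiagram_zero (μ : Nat.Partition n) :
    μ.youngDiagram.rowLen 0 = μ.parts.sup := by
  rcases Nat.eq_zero_or_pos n with rfl | hn
  · have h1 := rowLen_youngDiagram_zero_le μ
    have h2 := partitionNumerics_sup_parts_le μ
    omega
  · obtain ⟨ν, hs⟩ := exists_sortedParts_eq_sup_cons μ hn.ne'
    rw [youngDiagram_eq_ofRowLens_cons hs (sortedGE_cons_of_sortedParts_eq hs)]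
    exact rowLen_ofRowLens_cons_zero _

/-- The first column of the Young diagram of `μ` has `card μ.parts` boxes (the number of rows).
[folklore] -/
theorem partitionNumerics_colLen_youngDiagram_zero (μ : Nat.Partition n) :
    μ.youngDiagram.colLen 0 = Multiset.card μ.parts := by
  rw [← YoungDiagram.length_rowLens, μ.rowLens_youngDiagram, μ.length_sortedParts]

/-- **`card μᵀ.parts = μ₁`**: the transpose partition has as many parts as the first row of `μ`
has boxes (Fulton, *Young Tableaux*, §0, conjugate partition). [folklore] -/
theorem partitionNumerics_card_parts_transpose (μ : Nat.Partition n) :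
    Multiset.card μ.transpose.parts = μ.parts.sup := by
  rw [← partitionNumerics_colLen_youngDiagram_zero, μ.youngDiagram_transpose,
    YoungDiagram.colLen_transpose, partitionNumerics_rowLen_youngDiagram_zero]

/-- **`(μᵀ)₁ = card μ.parts`**: the largest part of the transpose partition is the number of
parts of `μ` (Fulton, *Young Tableaux*, §0, conjugate partition). [folklore] -/
theorem partitionNumerics_sup_parts_transpose (μ : Nat.Partition n) :
    μ.transpose.parts.sup = Multiset.card μ.parts := by
  rw [← partitionNumerics_rowLen_youngDiagram_zero, μ.youngDiagram_transpose,
    YoungDiagram.rowLen_transpose, partitionNumerics_colLen_youngDiagram_zero]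

/-- **`f^{μᵀ} = f^μ`**: transposition preserves the number of standard Young tableaux
(`dim S^{μᵀ} = dim S^μ` through the linear equivalence `S^μ ≃ S^{μᵀ}` of
`spechtIdealTransposeEquiv` over `ℚ`, and `dim S^μ = f^μ`, `finrank_spechtIdeal_holds`). [folklore] -/
theorem partitionNumerics_numStandardTableaux_transpose (μ : Nat.Partition n) :
    numStandardTableaux μ.transpose = numStandardTableaux μ := by
  rw [← finrank_spechtIdeal_holds ℚ μ, ← finrank_spechtIdeal_holds ℚ μ.transpose]
  exact (spechtIdealTransposeEquiv ℚ μ).finrank_eq.symm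

/-- **One column**: if `μ ⊢ n` has `n` parts then `f^μ = 1`. [folklore] -/
theorem partitionNumerics_eq_one_of_card_eq (μ : Nat.Partition n)
    (h : Multiset.card μ.parts = n) : numStandardTableaux μ = 1 := by
  rw [← partitionNumerics_numStandardTableaux_transpose]
  exact partitionNumerics_eq_one_of_sup_eq μ.transpose
    ((partitionNumerics_sup_parts_transpose μ).trans h)

/-- **Column level `ℓ`**: if `μ ⊢ n` (`n ≠ 0`) has `n - ℓ` parts then `f^μ ≤ n^{(ℓ)}`. [folklore] -/
theorem partitionNumerics_le_descFactorial_of_card_eq (hn : n ≠ 0) (μ : Nat.Partition n) {ℓ : ℕ}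
    (h : Multiset.card μ.parts = n - ℓ) : numStandardTableaux μ ≤ n.descFactorial ℓ := by
  rw [← partitionNumerics_numStandardTableaux_transpose]
  exact partitionNumerics_le_descFactorial_of_sup_eq hn μ.transpose
    ((partitionNumerics_sup_parts_transpose μ).trans h)

end PartitionNumerics

/-- **Partition numerics at the two ends** (stub `stub_partitionNumerics` of the line
`flat-tail-truncation`). For `μ ⊢ n`, `n ≥ 1`: the largest part and the number of parts are `≤ n`;
if the largest part is `n` (one row) or the number of parts is `n` (one column) then `f^μ = 1`; and
a shape with first row `n - ℓ` (resp. first column `n - ℓ`) has `f^μ ≤ n^{(ℓ)} = n!/(n - ℓ)!`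
(first-row peeling of the hook length formula, `f^μ ≤ C(n, ℓ) · ℓ!`, and transposition). -/
theorem stub_partitionNumerics (n : ℕ) (hn : 1 ≤ n) (μ : Nat.Partition n) :
    μ.parts.sup ≤ n ∧ Multiset.card μ.parts ≤ n ∧
      (μ.parts.sup = n → numStandardTableaux μ = 1) ∧
      (Multiset.card μ.parts = n → numStandardTableaux μ = 1) ∧
      (∀ ℓ : ℕ, μ.parts.sup = n - ℓ → (numStandardTableaux μ : ℝ) ≤ (n.descFactorial ℓ : ℝ)) ∧
      (∀ ℓ : ℕ, Multiset.card μ.parts = n - ℓ →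
        (numStandardTableaux μ : ℝ) ≤ (n.descFactorial ℓ : ℝ)) := by
  have hn0 : n ≠ 0 := Nat.one_le_iff_ne_zero.1 hn
  refine ⟨partitionNumerics_sup_parts_le μ, partitionNumerics_card_parts_le μ,
    partitionNumerics_eq_one_of_sup_eq μ, partitionNumerics_eq_one_of_card_eq μ,
    fun ℓ h => ?_, fun ℓ h => ?_⟩
  · exact_mod_cast partitionNumerics_le_descFactorial_of_sup_eq hn0 μ h
  · exact_mod_cast partitionNumerics_le_descFactorial_of_card_eq hn0 μ h

end Summit.MatrixMultiplication.MatrixMultiplication.Theorems.GlobalBranch
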